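import Summits.CriticalPhenomena.PercolationContinuityZ3.Theorems.PercNearOneGluingNoHeavyConstsClusterSquareApicesQuadTwoPair
import HarnessLib

/-!
# Outerplanar graph plus independent apices: no CROSS-LINKAGE of four clash vertices at a rim-rooted cluster (endgame)

builds on p205010 (kernel theorem, internal audit signed; external expert review pending)

PAPER-2 track "percolation constants", part (ii), seat `prim-consts-1`, gen 22 (lane index
`run/shared/lean/prim/consts/CONSTANTS.md`, row A19; memo `FROM-prim-consts-1-g22-CROSS-LINKAGE.md`).
Support file for the crux `NoHeavyLowerTail` (stmt-CriticalPhenomena-4575; `--supports`).  Theorems only; no definitions, no sorries.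

THE POINT.  Gen 18 (`…ConstsClusterSquareQuadClash.lean`) proved CSQ/DUU/TS at `(a; b, c)` as soon as no QUADRUPLE clash occurs:
four clash vertices `y, y', z, z'` joined to the cluster `K = C_a(ω)` by positive pairs, with `y, z` in the `b`-cluster and `y', z'`
in the `c`-cluster of `ω`, and `y', z` in the `b`-cluster and `y, z'` in the `c`-cluster of the second configuration off `K̄`.  Forget
the terminals: what remains is a CROSS-LINKAGE of the four clash vertices — walks `y → z`, `y' → z'` in `H − K` with disjoint supports
AND walks `y' → z`, `y → z'` in `H − K` with disjoint supports (two of the three perfect matchings of `{y, y', z, z'}` realised by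
disjoint connected sets off `K`).  THIS FILE: (i) `Consts.not_quadClash_of_unlinked₄` (general vertex type) — a quadruple
clash at `(a; b, c)` yields a cross-linkage at `C_a(ω)`, for ANY terminals `b, c` (they only glue the clusters);
(ii) `Consts.Apices.false_of_quad` — on an outerplanar rim graph plus an independent set of apices inside faces (the class
(I)(R)(F)(L)(L2) of `…ConstsClusterSquareApices.lean`), NO `H`-connected `K` containing a RIM vertex `a` carries a cross-linkage of
four clash vertices, whatever their types (rim or apex).  `…ConstsClusterSquareApicesQuad.lean` assembles: no quadruple clash at a
rim root for any two terminals, hence CSQ/DUU at every rim root and TS for every triple with a rim vertex.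

THE PROOF (cut the rim circle open at `a`; "gap" = master lemma `Consts.Apices.cnt_eq_of_walk`).  Each clash vertex `v` gets two RIM
representatives on its two walks: `v` itself if `v` is on the rim, else its rim neighbours on the walks (`v_ω` on the first
linkage, `v_θ` on the second).  (1) SEPARATION: `K ∪ supp(y → z)` is connected from `a` and avoided by `y' → z'`, and vice versa, so
no representative of one walk lies strictly between two of the other: the rim representatives of `y → z` lie on one side of those of
`y' → z'`; likewise for the second linkage.  (2) Comparing the two orientations, one of the pairs `(y, y')`, `(z, z')` (or its
mirror) has `v_ω < w_ω` and `w_θ < v_θ`.  (3) TWO-PAIR ENDGAME (`Consts.Apices.false_of_twoPair` of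
`…ConstsClusterSquareApicesQuadTwoPair.lean`): the two representatives of a clash vertex lie in one gap of the rim part of `K`; if
`v` is a rim vertex, it lies strictly between the two representatives of the apex `w`, and the `Hp K`-edge
joining `v` to `K` interleaves the chord `{w_θ, w_ω}` of `w` ((F)/(L)); if both are apices, either a representative of one lies strictly
inside the chord of the other (its chord to the `K`-neighbour interleaves, (L)), or the two chords coincide — two apices with two
common neighbours `p, q` and `K`-neighbours outside `[p, q]`: a third common neighbour ((L2)) or interleaving chords ((L)).
Census of the exact combinatorial statement (lane engine g22 `eng/quad4.py`, kit job j214549; exhaustive over ALL (I)(R)(F)(L)(L2)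
graphs): two apices, ≤ 6 rim vertices (4 288 / 62 944 / 884 096 graphs; at 6 rim vertices 186 495 348 rim-rooted clusters, 6 746 298
of them with one realisable matching): 0 cross-linkages; three apices, ≤ 5 rim vertices (19 840 / 390 144 graphs, 80 228 110
clusters): 0; one apex, ≤ 7 rim vertices (804 864 graphs at 7, 165 345 852 clusters): 0.  Controls (two apices, 5 rim vertices):
apex ROOT 456 cross-linked clusters (`W₄`-type), (L) dropped 4 405, (L2) dropped 5 100, (F) dropped 47 785.
References: N. Gladkov, arXiv:2408.08457v2 (2024), Def. 4.2, Thm. 4.3, Lemma 3.1, Ex. 2.5; G. Chartrand, F. Harary,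
Ann. Inst. H. Poincaré B 3 (1967) 433–438 (outerplanar graphs).
-/

noncomputable section

open Classical

namespace Summit.CriticalPhenomena.PercolationContinuityZ3.Theorems

open MeasureTheory Finset Literature.Probability.LatticeModels Literature.Probability.Percolation
open Literature.Probability.Percolation.DecisionTree Literature.Probability.Percolation.BHK2006
open Literature.Probability.Percolation.TargetExploration Literature.Probability.Percolation.ClusterConditioning

namespace Consts

namespace Apices

variable {n m : ℕ} {pos : Fin n → Fin m} {hub : Fin n → Prop}

/-- ORIENTATION: four values `A, B` (one side) and `C, D` (other side), pairwise distinct across the sides, such that neither of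
`A, B` is strictly between `C, D` and neither of `C, D` strictly between `A, B`, are separated: `A, B < C, D` or `C, D < A, B`.
[folklore] -/
private theorem arith_orient {A B C D : ℕ} (dAC : A ≠ C) (dAD : A ≠ D) (dBC : B ≠ C) (dBD : B ≠ D)
    (n1 : ¬ (C < A ∧ A < D) ∧ ¬ (D < A ∧ A < C)) (n2 : ¬ (C < B ∧ B < D) ∧ ¬ (D < B ∧ B < C))
    (n3 : ¬ (A < C ∧ C < B) ∧ ¬ (B < C ∧ C < A)) (n4 : ¬ (A < D ∧ D < B) ∧ ¬ (B < D ∧ D < A)) :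
    (A < C ∧ A < D ∧ B < C ∧ B < D) ∨ (C < A ∧ D < A ∧ C < B ∧ D < B) := by
  omega

section Endgame

variable {H G₀ : SimpleGraph (Fin n)} {Hp : Set (Fin n) → SimpleGraph (Fin n)} {C : Fin n → SimpleGraph (Fin n)} {a : Fin n}
  (hpos : ∀ u v, ¬ hub u → ¬ hub v → pos u = pos v → u = v)
  (hI : ∀ u v, hub u → hub v → ¬ H.Adj u v)
  (g1 : ∀ u v, H.Adj u v → ¬ hub u → ¬ hub v → G₀.Adj u v)
  (g2 : ∀ S u v, H.Adj u v → ¬ hub u → ¬ hub v → (Hp S).Adj u v)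
  (g3 : ∀ (S : Set (Fin n)) x u v, hub x → x ∈ S → u ≠ v → ¬ hub u → ¬ hub v → H.Adj x u → H.Adj x v → (Hp S).Adj u v)
  (c1 : ∀ x u v, hub x → u ≠ v → ¬ hub u → ¬ hub v → H.Adj x u → H.Adj x v → (C x).Adj u v)
  (x0 : ∀ (S : Set (Fin n)) p q r s, (Hp S).Adj p q → G₀.Adj r s → (pos p - pos a).val < (pos r - pos a).val →
    (pos r - pos a).val < (pos q - pos a).val → (pos q - pos a).val < (pos s - pos a).val → False)
  (x0' : ∀ (S : Set (Fin n)) p q r s, G₀.Adj p q → (Hp S).Adj r s → (pos p - pos a).val < (pos r - pos a).val →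
    (pos r - pos a).val < (pos q - pos a).val → (pos q - pos a).val < (pos s - pos a).val → False)
  (xC : ∀ (S : Set (Fin n)) x p q r s, hub x → x ∉ S → (Hp S).Adj p q → (C x).Adj r s →
    (pos p - pos a).val < (pos r - pos a).val → (pos r - pos a).val < (pos q - pos a).val →
    (pos q - pos a).val < (pos s - pos a).val → False)
  (xC' : ∀ (S : Set (Fin n)) x p q r s, hub x → x ∉ S → (C x).Adj p q → (Hp S).Adj r s →
    (pos p - pos a).val < (pos r - pos a).val → (pos r - pos a).val < (pos q - pos a).val →
    (pos q - pos a).val < (pos s - pos a).val → False)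
  (xCC : ∀ x x' p q r s, hub x → hub x' → x ≠ x' → (C x).Adj p q → (C x').Adj r s →
    (pos p - pos a).val < (pos r - pos a).val → (pos r - pos a).val < (pos q - pos a).val →
    (pos q - pos a).val < (pos s - pos a).val → False)
  (ha : ¬ hub a)
include hpos hI g1 g2 g3 c1 x0 x0' xC xC' xCC ha

/-- **NO CROSS-LINKAGE (endgame, several apices).**  An `H`-connected `K ∋ a` (`a` on the rim, walk form) and four clash vertices
`y, y', z, z' ∉ K`, each joined to `K`, with `y ≠ y'`, `z ≠ z'`, CANNOT carry walks `R₁ : y → z`, `R₂ : y' → z'` avoiding `K` with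
disjoint supports together with walks `R₃ : y' → z`, `R₄ : y → z'` avoiding `K` with disjoint supports — given rim representatives of
the clash vertices on their walks (`Consts.Apices.exists_reps`).  Separation of the representatives of `R₁`/`R₂` and of `R₃`/`R₄`
(master gap lemma for `K ∪ supp Rᵢ`), then `Consts.Apices.false_of_twoPair` for the pair `(y, y')` or `(z, z')`.
[folklore: Jordan curve theorem] -/
theorem false_of_quad (hL2 : ∀ x x' u v w, hub x → hub x' → x ≠ x' → u ≠ v → u ≠ w → v ≠ w →
      H.Adj x u → H.Adj x v → H.Adj x w → H.Adj x' u → H.Adj x' v → H.Adj x' w → False)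
    {K : Set (Fin n)} (hKw : ∀ s ∈ K, ∃ W : H.Walk a s, ∀ v ∈ W.support, v ∈ K)
    {y y' z z' yω yθ y'ω y'θ zω zθ z'ω z'θ ky ky' kz kz' : Fin n}
    (hyK : y ∉ K) (hy'K : y' ∉ K) (hzK : z ∉ K) (hz'K : z' ∉ K)
    (hkyK : ky ∈ K) (hky : H.Adj ky y) (hky'K : ky' ∈ K) (hky' : H.Adj ky' y')
    (hkzK : kz ∈ K) (hkz : H.Adj kz z) (hkz'K : kz' ∈ K) (hkz' : H.Adj kz' z')
    (hyy' : y ≠ y') (hzz' : z ≠ z')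
    (R₁ : H.Walk y z) (R₂ : H.Walk y' z') (hR₁ : ∀ x ∈ R₁.support, x ∉ K) (hR₂ : ∀ x ∈ R₂.support, x ∉ K)
    (hd₁₂ : ∀ x, x ∈ R₁.support → x ∉ R₂.support)
    (R₃ : H.Walk y' z) (R₄ : H.Walk y z') (hR₃ : ∀ x ∈ R₃.support, x ∉ K) (hR₄ : ∀ x ∈ R₄.support, x ∉ K)
    (hd₃₄ : ∀ x, x ∈ R₃.support → x ∉ R₄.support)
    (hyω : ¬ hub yω) (hyωR : yω ∈ R₁.support) (hyθ : ¬ hub yθ) (hyθR : yθ ∈ R₄.support)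
    (hy : (¬ hub y ∧ yω = y ∧ yθ = y) ∨ (hub y ∧ H.Adj y yω ∧ H.Adj y yθ))
    (hy'ω : ¬ hub y'ω) (hy'ωR : y'ω ∈ R₂.support) (hy'θ : ¬ hub y'θ) (hy'θR : y'θ ∈ R₃.support)
    (hy' : (¬ hub y' ∧ y'ω = y' ∧ y'θ = y') ∨ (hub y' ∧ H.Adj y' y'ω ∧ H.Adj y' y'θ))
    (hzω : ¬ hub zω) (hzωR : zω ∈ R₁.support) (hzθ : ¬ hub zθ) (hzθR : zθ ∈ R₃.support)
    (hz : (¬ hub z ∧ zω = z ∧ zθ = z) ∨ (hub z ∧ H.Adj z zω ∧ H.Adj z zθ))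
    (hz'ω : ¬ hub z'ω) (hz'ωR : z'ω ∈ R₂.support) (hz'θ : ¬ hub z'θ) (hz'θR : z'θ ∈ R₄.support)
    (hz' : (¬ hub z' ∧ z'ω = z' ∧ z'θ = z') ∨ (hub z' ∧ H.Adj z' z'ω ∧ H.Adj z' z'θ)) : False := by
  have P : ∀ u v : Fin n, ¬ hub u → ¬ hub v → u ≠ v → (pos u - pos a).val ≠ (pos v - pos a).val :=
    fun u v hu hv huv e => huv (hpos u v hu hv (NonCrossing.rot_injective (pos a) e))
  -- representatives are outside `K`
  have hyωK : yω ∉ K := hR₁ _ hyωR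
  have hzωK : zω ∉ K := hR₁ _ hzωR
  have hy'ωK : y'ω ∉ K := hR₂ _ hy'ωR
  have hz'ωK : z'ω ∉ K := hR₂ _ hz'ωR
  have hy'θK : y'θ ∉ K := hR₃ _ hy'θR
  have hzθK : zθ ∉ K := hR₃ _ hzθR
  have hyθK : yθ ∉ K := hR₄ _ hyθR
  have hz'θK : z'θ ∉ K := hR₄ _ hz'θR
  -- distinct positions across the two sides of each linkage
  have d1 := P yω y'ω hyω hy'ω (fun e => hd₁₂ _ hyωR (e ▸ hy'ωR))
  have d2 := P yω z'ω hyω hz'ω (fun e => hd₁₂ _ hyωR (e ▸ hz'ωR))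
  have d3 := P zω y'ω hzω hy'ω (fun e => hd₁₂ _ hzωR (e ▸ hy'ωR))
  have d4 := P zω z'ω hzω hz'ω (fun e => hd₁₂ _ hzωR (e ▸ hz'ωR))
  have d5 := P y'θ yθ hy'θ hyθ (fun e => hd₃₄ _ hy'θR (e ▸ hyθR))
  have d6 := P y'θ z'θ hy'θ hz'θ (fun e => hd₃₄ _ hy'θR (e ▸ hz'θR))
  have d7 := P zθ yθ hzθ hyθ (fun e => hd₃₄ _ hzθR (e ▸ hyθR))
  have d8 := P zθ z'θ hzθ hz'θ (fun e => hd₃₄ _ hzθR (e ▸ hz'θR))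
  -- links of the four clash vertices to rim vertices of `K`
  obtain ⟨ly, hlyK, hly, Ly⟩ := clash_link hI g2 g3 ha hKw hyK hkyK hky hy
  obtain ⟨ly', hly'K, hly', Ly'⟩ := clash_link hI g2 g3 ha hKw hy'K hky'K hky' hy'
  obtain ⟨lz, hlzK, hlz, Lz⟩ := clash_link hI g2 g3 ha hKw hzK hkzK hkz hz
  obtain ⟨lz', hlz'K, hlz', Lz'⟩ := clash_link hI g2 g3 ha hKw hz'K hkz'K hkz' hz'
  -- (0) the two representatives of a clash vertex lie in one gap of the rim part of `K`: no link strictly between them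
  have gap : ∀ {v p q l : Fin n}, v ∉ K → p ∉ K → q ∉ K → ¬ hub p → ¬ hub q → l ∈ K → ¬ hub l →
      ((¬ hub v ∧ p = v ∧ q = v) ∨ (hub v ∧ H.Adj v p ∧ H.Adj v q)) →
      ¬ ((pos p - pos a).val < (pos l - pos a).val ∧ (pos l - pos a).val < (pos q - pos a).val) ∧
        ¬ ((pos q - pos a).val < (pos l - pos a).val ∧ (pos l - pos a).val < (pos p - pos a).val) := by
    intro v p q l hvK hpK hqK hp hq hlK hl hv
    rcases hv with ⟨-, h1, h2⟩ | ⟨hvh, h1, h2⟩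
    · rw [h1, h2]
      exact ⟨fun h => lt_asymm h.1 h.2, fun h => lt_asymm h.1 h.2⟩
    · exact NonCrossing.not_between_of_cnt_eq_pos' a _ (cnt_eq_of_hubAdj hpos hI g2 g3 c1 xC xC' ha hKw
        (S' := {v | v ∈ K ∧ ¬ hub v}) (fun _ => Iff.rfl) hvh hvK hpK hqK hp hq h1 h2) ⟨hlK, hl⟩
  have gy_y' := gap hy'K hy'ωK hy'θK hy'ω hy'θ hlyK hly hy'     -- the link of y is not between the reps of y'
  have gy'_y := gap hyK hyωK hyθK hyω hyθ hly'K hly' hy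
  have gz_z' := gap hz'K hz'ωK hz'θK hz'ω hz'θ hlzK hlz hz'
  have gz'_z := gap hzK hzωK hzθK hzω hzθ hlz'K hlz' hz
  -- (1) separation of the representatives of `R₁` and `R₂`
  have hS₁ := NonCrossing.walks_extend hKw hkyK hky R₁
  have f1 := cnt_eq_of_walk hpos hI g1 g2 g3 c1 x0 x0' xC xC' ha hS₁
    (S' := {v | v ∈ K ∪ {v | v ∈ R₁.support} ∧ ¬ hub v}) (fun _ => Iff.rfl) R₂
    (fun v hv hvS => by
      rcases hvS with hvK | hvR
      · exact hR₂ v hv hvK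
      · exact hd₁₂ v hvR hv) y'ω hy'ωR z'ω hz'ωR hy'ω hz'ω
  have hS₂ := NonCrossing.walks_extend hKw hky'K hky' R₂
  have f2 := cnt_eq_of_walk hpos hI g1 g2 g3 c1 x0 x0' xC xC' ha hS₂
    (S' := {v | v ∈ K ∪ {v | v ∈ R₂.support} ∧ ¬ hub v}) (fun _ => Iff.rfl) R₁
    (fun v hv hvS => by
      rcases hvS with hvK | hvR
      · exact hR₁ v hv hvK
      · exact hd₁₂ v hv hvR) yω hyωR zω hzωR hyω hzω
  have n1 := NonCrossing.not_between_of_cnt_eq_pos' a _ f1 ⟨Or.inr hyωR, hyω⟩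
  have n2 := NonCrossing.not_between_of_cnt_eq_pos' a _ f1 ⟨Or.inr hzωR, hzω⟩
  have n3 := NonCrossing.not_between_of_cnt_eq_pos' a _ f2 ⟨Or.inr hy'ωR, hy'ω⟩
  have n4 := NonCrossing.not_between_of_cnt_eq_pos' a _ f2 ⟨Or.inr hz'ωR, hz'ω⟩
  have hω := arith_orient d1 d2 d3 d4 n1 n2 n3 n4
  -- (2) separation of the representatives of `R₃` and `R₄` (sides: `y', z` on `R₃`; `y, z'` on `R₄`)
  have hS₃ := NonCrossing.walks_extend hKw hky'K hky' R₃
  have f3 := cnt_eq_of_walk hpos hI g1 g2 g3 c1 x0 x0' xC xC' ha hS₃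
    (S' := {v | v ∈ K ∪ {v | v ∈ R₃.support} ∧ ¬ hub v}) (fun _ => Iff.rfl) R₄
    (fun v hv hvS => by
      rcases hvS with hvK | hvR
      · exact hR₄ v hv hvK
      · exact hd₃₄ v hvR hv) yθ hyθR z'θ hz'θR hyθ hz'θ
  have hS₄ := NonCrossing.walks_extend hKw hkyK hky R₄
  have f4 := cnt_eq_of_walk hpos hI g1 g2 g3 c1 x0 x0' xC xC' ha hS₄
    (S' := {v | v ∈ K ∪ {v | v ∈ R₄.support} ∧ ¬ hub v}) (fun _ => Iff.rfl) R₃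
    (fun v hv hvS => by
      rcases hvS with hvK | hvR
      · exact hR₃ v hv hvK
      · exact hd₃₄ v hv hvR) y'θ hy'θR zθ hzθR hy'θ hzθ
  have n5 := NonCrossing.not_between_of_cnt_eq_pos' a _ f3 ⟨Or.inr hy'θR, hy'θ⟩
  have n6 := NonCrossing.not_between_of_cnt_eq_pos' a _ f3 ⟨Or.inr hzθR, hzθ⟩
  have n7 := NonCrossing.not_between_of_cnt_eq_pos' a _ f4 ⟨Or.inr hyθR, hyθ⟩
  have n8 := NonCrossing.not_between_of_cnt_eq_pos' a _ f4 ⟨Or.inr hz'θR, hz'θ⟩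
  have hθ := arith_orient d5 d6 d7 d8 n5 n6 n7 n8
  -- (3) the four orientation cases
  rcases hω with ⟨o1, _, _, o4⟩ | ⟨o1, _, _, o4⟩ <;> rcases hθ with ⟨t1, _, _, t4⟩ | ⟨t1, _, _, t4⟩
  · -- yω < y'ω and y'θ < yθ : the pair (y, y')
    exact false_of_twoPair hpos c1 xC xC' xCC hL2 hyy' hyK hy'K hyω hyθ hy'ω hy'θ hyωK hyθK hy'ωK hy'θK
      hlyK hly hly'K hly' Ly Ly' gy_y' gy'_y o1 t1
  · -- yω < y'ω, zω < z'ω and yθ < y'θ, z'θ < zθ : the pair (z, z')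
    exact false_of_twoPair hpos c1 xC xC' xCC hL2 hzz' hzK hz'K hzω hzθ hz'ω hz'θ hzωK hzθK hz'ωK hz'θK
      hlzK hlz hlz'K hlz' Lz Lz' gz_z' gz'_z o4 t4
  · -- y'ω < yω, z'ω < zω and y'θ < yθ, zθ < z'θ : the pair (z', z)
    exact false_of_twoPair hpos c1 xC xC' xCC hL2 hzz'.symm hz'K hzK hz'ω hz'θ hzω hzθ hz'ωK hz'θK hzωK hzθK
      hlz'K hlz' hlzK hlz Lz' Lz gz'_z gz_z' o4 t4
  · -- y'ω < yω and yθ < y'θ : the pair (y', y)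
    exact false_of_twoPair hpos c1 xC xC' xCC hL2 hyy'.symm hy'K hyK hy'ω hy'θ hyω hyθ hy'ωK hy'θK hyωK hyθK
      hly'K hly' hlyK hly Ly' Ly gy'_y gy_y' o1 t1

end Endgame

end Apices

/-! ### Quadruple clashes, combinatorially: a cross-linkage of the four clash vertices -/

section General

variable {V : Type*}

/-- **No quadruple clash unless some cluster of `a` carries a cross-linkage of four clash vertices.**  `H` carries the positive
pairs.  Suppose that for every `K ∋ a`, `H`-connected from `a`, and all pairwise distinct `y, y', z, z'` outside `K`, each joined to
`K`: EITHER every two walks `y → z`, `y' → z'` in `H − K` meet, OR every two walks `y' → z`, `y → z'` in `H − K` meet.  Then the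
no-quadruple-clash hypothesis of `Consts.clusterSquare_le_sq_of_noQuadClash_pos` holds at `(a; b, c)` for EVERY `b, c` (the
terminals only glue `y, z, b` / `y', z', c` in the first configuration and `y', z, b` / `y, z', c` in the second).
[folklore; input for Gladkov2024, Thm. 4.3] -/
theorem not_quadClash_of_unlinked₄ (H : SimpleGraph V) (w : Sym2 V → unitInterval) {a b c : V}
    (hH : ∀ u v, u ≠ v → (0 : ℝ) < w s(u, v) → H.Adj u v)
    (hK : ∀ (K : Set V) (y y' z z' : V), a ∈ K →
      (∀ T : Set V, a ∈ T → (∀ u x, u ∈ T → H.Adj u x → x ∈ K → x ∈ T) → K ⊆ T) →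
      y ∉ K → y' ∉ K → z ∉ K → z' ∉ K →
      (∃ k, k ∈ K ∧ H.Adj k y) → (∃ k, k ∈ K ∧ H.Adj k y') → (∃ k, k ∈ K ∧ H.Adj k z) → (∃ k, k ∈ K ∧ H.Adj k z') →
      y ≠ y' → y ≠ z → y ≠ z' → y' ≠ z → y' ≠ z' → z ≠ z' →
      (∀ (R₁ : H.Walk y z) (R₂ : H.Walk y' z'), (∀ x ∈ R₁.support, x ∉ K) → (∀ x ∈ R₂.support, x ∉ K) →
          ∃ x, x ∈ R₁.support ∧ x ∈ R₂.support) ∨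
      (∀ (R₃ : H.Walk y' z) (R₄ : H.Walk y z'), (∀ x ∈ R₃.support, x ∉ K) → (∀ x ∈ R₄.support, x ∉ K) →
          ∃ x, x ∈ R₃.support ∧ x ∈ R₄.support))
    {ω η : Set (Sym2 V)} (hω : ∀ e ∈ ω, (0 : ℝ) < w e) (hη : ∀ e ∈ η, (0 : ℝ) < w e)
    (hab : ¬ (openGraph ω).Reachable a b) (hac : ¬ (openGraph ω).Reachable a c) (hbc : ¬ (openGraph ω).Reachable b c)
    (hbc' : ¬ (openGraph (η \ barOf {a} (setCl ω {a}))).Reachable b c) :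
    ¬ ((∃ y k : V, (openGraph ω).Reachable a k ∧ (0 : ℝ) < w s(k, y) ∧ (openGraph ω).Reachable b y ∧
          (openGraph (η \ barOf {a} (setCl ω {a}))).Reachable c y) ∧
       (∃ y k : V, (openGraph ω).Reachable a k ∧ (0 : ℝ) < w s(k, y) ∧ (openGraph ω).Reachable c y ∧
          (openGraph (η \ barOf {a} (setCl ω {a}))).Reachable b y) ∧
       (∃ y k : V, (openGraph ω).Reachable a k ∧ (0 : ℝ) < w s(k, y) ∧ (openGraph ω).Reachable b y ∧
          (openGraph (η \ barOf {a} (setCl ω {a}))).Reachable b y) ∧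
       (∃ y k : V, (openGraph ω).Reachable a k ∧ (0 : ℝ) < w s(k, y) ∧ (openGraph ω).Reachable c y ∧
          (openGraph (η \ barOf {a} (setCl ω {a}))).Reachable c y)) := by
  rintro ⟨⟨y, k, hk, hw, hby, hcy⟩, ⟨y', k', hk', hw', hcy', hby'⟩, ⟨z, k₃, hk₃, hw₃, hbz, hbz'⟩, ⟨z', k₄, hk₄, hw₄, hcz, hcz'⟩⟩
  set θ := η \ barOf {a} (setCl ω {a}) with hθdef
  set K : Set V := {x | (openGraph ω).Reachable a x} with hKdef
  have hadjH : ∀ (ξ : Set (Sym2 V)), (∀ e ∈ ξ, (0 : ℝ) < w e) → openGraph ξ ≤ H := by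
    intro ξ hξ u v huv
    rw [openGraph_adj] at huv
    exact hH u v huv.2 (hξ _ huv.1)
  have hθ : ∀ e ∈ θ, (0 : ℝ) < w e := fun e he => hη e he.1
  have hθK : ∀ u v, (openGraph θ).Adj u v → ¬ (openGraph ω).Reachable a v := by
    intro u v huv hav
    rw [openGraph_adj, hθdef, barOf_setCl_singleton_eq_cutSet] at huv
    exact huv.1.2 ⟨v, Sym2.mem_mk_right u v, hav⟩
  have hyK : y ∉ K := fun h => hab (h.trans hby.symm)
  have hy'K : y' ∉ K := fun h => hac (h.trans hcy'.symm)
  have hzK : z ∉ K := fun h => hab (h.trans hbz.symm)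
  have hz'K : z' ∉ K := fun h => hac (h.trans hcz.symm)
  have hky : H.Adj k y := hH k y (fun h => hyK (h ▸ hk)) hw
  have hky' : H.Adj k' y' := hH k' y' (fun h => hy'K (h ▸ hk')) hw'
  have hk₃z : H.Adj k₃ z := hH k₃ z (fun h => hzK (h ▸ hk₃)) hw₃
  have hk₄z' : H.Adj k₄ z' := hH k₄ z' (fun h => hz'K (h ▸ hk₄)) hw₄
  have hconn : ∀ T : Set V, a ∈ T → (∀ u x, u ∈ T → H.Adj u x → x ∈ K → x ∈ T) → K ⊆ T := by
    intro T haT hT x hx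
    obtain ⟨X⟩ := id hx
    exact mem_of_openWalk_adm H T (fun z => z ∈ K) (fun u z hu huz hz => hT u z hu huz hz) (hadjH ω hω) X haT
      fun z hz => Or.inr (show (openGraph ω).Reachable a z from ⟨X.takeUntil z hz⟩)
  -- the four walks: `y → z` via `b` and `y' → z'` via `c` in `ω`; `y' → z` via `b` and `y → z'` via `c` in `θ`
  obtain ⟨W₁⟩ := hby.symm.trans hbz
  obtain ⟨W₂⟩ := hcy'.symm.trans hcz
  obtain ⟨W₃⟩ := hby'.symm.trans hbz'
  obtain ⟨W₄⟩ := hcy.symm.trans hcz'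
  have hW₁ : ∀ x ∈ W₁.support, (openGraph ω).Reachable b x := fun x hx => hby.trans ⟨W₁.takeUntil x hx⟩
  have hW₂ : ∀ x ∈ W₂.support, (openGraph ω).Reachable c x := fun x hx => hcy'.trans ⟨W₂.takeUntil x hx⟩
  have hW₃ : ∀ x ∈ W₃.support, (openGraph θ).Reachable b x := fun x hx => hby'.trans ⟨W₃.takeUntil x hx⟩
  have hW₄ : ∀ x ∈ W₄.support, (openGraph θ).Reachable c x := fun x hx => hcy.trans ⟨W₄.takeUntil x hx⟩
  have hW₃K : ∀ x ∈ W₃.support, x ∉ K := not_reachable_of_mem_support a hθK W₃ hy'K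
  have hW₄K : ∀ x ∈ W₄.support, x ∉ K := not_reachable_of_mem_support a hθK W₄ hyK
  rcases hK K y y' z z' (SimpleGraph.Reachable.refl a) hconn hyK hy'K hzK hz'K ⟨k, hk, hky⟩ ⟨k', hk', hky'⟩ ⟨k₃, hk₃, hk₃z⟩
      ⟨k₄, hk₄, hk₄z'⟩ (fun h => hbc (hby.trans (by rw [h]; exact hcy'.symm)))
      (fun h => hbc' (hbz'.trans (by rw [← h]; exact hcy.symm))) (fun h => hbc (hby.trans (by rw [h]; exact hcz.symm)))
      (fun h => hbc (hbz.trans (by rw [← h]; exact hcy'.symm))) (fun h => hbc' (hby'.trans (by rw [h]; exact hcz'.symm)))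
      (fun h => hbc (hbz.trans (by rw [h]; exact hcz.symm))) with hlink | hlink
  · have e₁ := SimpleGraph.Walk.support_mapLe_eq_support (hadjH ω hω) W₁
    have e₂ := SimpleGraph.Walk.support_mapLe_eq_support (hadjH ω hω) W₂
    obtain ⟨x, hx₁, hx₂⟩ := hlink (W₁.mapLe (hadjH ω hω)) (W₂.mapLe (hadjH ω hω))
      (fun x hx => fun hxK => hab (hxK.trans (hW₁ x (by rwa [e₁] at hx)).symm))
      (fun x hx => fun hxK => hac (hxK.trans (hW₂ x (by rwa [e₂] at hx)).symm))
    rw [e₁] at hx₁; rw [e₂] at hx₂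
    exact hbc ((hW₁ x hx₁).trans (hW₂ x hx₂).symm)
  · have e₃ := SimpleGraph.Walk.support_mapLe_eq_support (hadjH _ hθ) W₃
    have e₄ := SimpleGraph.Walk.support_mapLe_eq_support (hadjH _ hθ) W₄
    obtain ⟨x, hx₃, hx₄⟩ := hlink (W₃.mapLe (hadjH _ hθ)) (W₄.mapLe (hadjH _ hθ))
      (fun x hx => hW₃K x (by rwa [e₃] at hx)) (fun x hx => hW₄K x (by rwa [e₄] at hx))
    rw [e₃] at hx₃; rw [e₄] at hx₄
    exact hbc' ((hW₃ x hx₃).trans (hW₄ x hx₄).symm)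

end General

end Consts

end Summit.CriticalPhenomena.PercolationContinuityZ3.Theorems
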